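import Literature.NumberTheory.GaloisRepresentations.NeukirchAbstractExistence
import Literature.NumberTheory.GaloisRepresentations.NeukirchAbstractBounded
import Literature.GroupTheory.ProfiniteOrbitClosure
import HarnessLib

/-!
# Neukirch's characterisation of decomposition groups, abstract core IV: containment

Topic `NumberTheory/GaloisRepresentations`; namespace
`Literature.NumberTheory.GaloisRepresentations.NeukirchAbstract`.  Proof file: theorems only (no
definition, no instance, no named fact).  Fourth abstract file (after `…Uniqueness`, `…Existence`,
`…Bounded`; same conventions: one ambient profinite `Γ` acting on a set `P` of "primes" with closed
stabilisers `D p`, `ℓ`-torsion classes = locally constant `2`-cocycles `Γ → Γ → R` on subgroups, `R` a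
field, coboundary predicate `Cob` bound with its defining equivalence `hCob`).

**Theorem** (`exists_prime_smul_eq_of_localType`, abstract form of [NSW] Prop. (12.1.9) = Neukirch's
lemma "a closed subgroup of local type of `Γ_K` lies in a decomposition group").  Let `V₀ ≤ Γ` be an
open normal subgroup (for `Γ_K`: `Γ_{K(μ_ℓ)}`) and assume, for the open subgroups `V ≤ V₀` and all
primes `p`: Hasse injectivity (AxH), finite support (AxF), local dimension `≤ 1` (AxD), two-place
existence (AxG), finitely many `Γ`-orbits over each rational prime, and the three LOCAL facts on the
groups `D p ∩ W` (`W ≤ V₀` open): `H² ≠ 0` (AxLn), restriction to `D p ∩ W'` kills `H²` when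
`ℓ ∣ [D p ∩ W : D p ∩ W']` (AxLv) and is injective when `ℓ ∤ [D p ∩ W : D p ∩ W']` (AxLi) — for `Γ_K`:
Albert–Brauer–Hasse–Noether, `|H²(Γ_k, μ_ℓ)| = ℓ` for `ζ_ℓ ∈ k` and `res = [L : E]` on local
invariants (the tree's `BrauerHassePrinciple`, `TateLocalH2Nonvanishing`/`TateLocalH2Pigeonhole`,
`LocalBrauerRestrictionDegree`, `BrauerTower`, `CharacterPrescribedLocalComponents`).  Let `H' ≤ V₀`
be CLOSED and OF LOCAL TYPE: for every open normal `N ⊴ Γ`, `H²(H' ∩ N) ≠ 0` of dimension `≤ 1`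
(AxL — for `Γ_K`: `H'` topologically isomorphic to an open subgroup of a decomposition group on which
`μ_ℓ` is trivial).  Then there is a prime `p` fixed by EVERY `h ∈ Γ` normalising `H'`; in
particular `H' ≤ D p` (`le_stabilizer_of_forall_conj`), and `H ≤ D p` whenever `H' ⊴ H`.

Proof (Neukirch): by `exists_prime_forall_not_coboundary` each `H' ∩ N` has a prime `p_N` at which
a class survives at all open levels; by (AxLv) the `ℓ`-part of `[D p_N ∩ V₀ : D p_N ∩ V]` stays
bounded over the open `V ⊇ H' ∩ N` (`exists_bound_of_forall_not_coboundary`), a property inherited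
UPWARDS to `H' = H' ∩ ⊤`, transported by conjugation (`bounded_conj`), and converted back into a
surviving local class by (AxLn)/(AxLi) (`exists_surviving_of_bounded`); the uniqueness theorem
`exists_mem_smul_eq_of_local_nonvanishing` shows `p_N ∈ H' • p_⊤`, so the single prime `p = p_⊤`
has bounded `ℓ`-part above EVERY `H' ∩ N`; for `h` normalising `H'` the primes `p` and `h • p` both
qualify above `H' ∩ N = h (H' ∩ N) h⁻¹`, whence `h • p ∈ (H' ∩ N) • p` for all `N`, i.e. `h • p = p`
(orbit closure, `exists_mem_smul_eq_of_forall_open`).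

HONEST FRAMING: classical (our kernel check); the number-field INSTANTIATION of the axioms (each a
dictionary statement over the tree's local/global class field theory) is separate work; written for
the abc-iut cell's GAP-LEDGER row G-L4d2g4-1 (campaign L); nothing here bears on [IUTchIII]
Cor. 3.12.

## References

* J. Neukirch, *Kennzeichnung der p-adischen und der endlichen algebraischen Zahlkörper*, Invent.
  Math. 6 (1969) 296–314. [Neukirch1969]
* J. Neukirch, A. Schmidt, K. Wingberg, *Cohomology of Number Fields* (2nd ed. 2008), XII §1,
  Prop. (12.1.9). [NeukirchSchmidtWingberg2008]
-/

open Topology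
open scoped Pointwise

universe u v w

namespace Literature.NumberTheory.GaloisRepresentations.NeukirchAbstract

open Literature.GroupTheory.LocallyConstantCocycles

variable {Γ : Type u} [Group Γ] [TopologicalSpace Γ]
variable {R : Type v} [Field R]

/-! ### The containment theorem -/

section Main

variable [IsTopologicalGroup Γ] [CompactSpace Γ] [TotallyDisconnectedSpace Γ]
variable {P : Type w} [MulAction Γ P] {ℓ : ℕ}
variable (Cob : Subgroup Γ → (Γ → Γ → R) → Prop)
  (hCob : ∀ (S : Subgroup Γ) (f : Γ → Γ → R), Cob S f ↔
    ∃ β : Γ → R, IsLocallyConstant (fun s : S => β s) ∧ ∀ a ∈ S, ∀ b ∈ S, f a b = β a + β b - β (a * b))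

include hCob

/-- **Neukirch's lemma, abstract form** ([NSW] Prop. (12.1.9)): under the local-global hypotheses
(AxH), (AxF), (AxD), (AxG), (AxLn), (AxLv), (AxLi) on the profinite `Γ`-set `P` (see the module
docstring), a closed subgroup `H' ≤ V₀` of LOCAL TYPE (AxL: `H²(H' ∩ N) ≠ 0` of dimension `≤ 1` for
every open normal `N`) determines a prime `p` fixed by every `h ∈ Γ` which normalises `H'`
(`h H' h⁻¹ = H'`).  For `Γ = Γ_K` and `H'` an open subgroup of a closed subgroup isomorphic to a
decomposition group: `H ≤ D_𝔓` for the normaliser `H` of `H'`.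
[cite: NeukirchSchmidtWingberg2008, Prop (12.1.9)] -/
theorem exists_prime_smul_eq_of_localType (hℓ : ℓ.Prime)
    (hst : ∀ p : P, IsClosed (MulAction.stabilizer Γ p : Set Γ))
    {ι : Type*} (π : P → ι)
    (hfib : ∀ i : ι, ∃ s : Finset P, ∀ p : P, π p = i → ∃ q ∈ s, ∃ g : Γ, g • q = p)
    {V₀ : Subgroup Γ} (hV₀ : IsOpen (V₀ : Set Γ)) [V₀.Normal]
    (AxH : ∀ V : Subgroup Γ, IsOpen (V : Set Γ) → V ≤ V₀ → ∀ f : Γ → Γ → R,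
      IsLocallyConstant (fun q : V × V => f q.1 q.2) →
      (∀ a ∈ V, ∀ b ∈ V, ∀ c ∈ V, f a b + f (a * b) c = f b c + f a (b * c)) →
      (∀ p : P, Cob (MulAction.stabilizer Γ p ⊓ V) f) → Cob V f)
    (AxF : ∀ V : Subgroup Γ, IsOpen (V : Set Γ) → V ≤ V₀ → ∀ f : Γ → Γ → R,
      IsLocallyConstant (fun q : V × V => f q.1 q.2) →
      (∀ a ∈ V, ∀ b ∈ V, ∀ c ∈ V, f a b + f (a * b) c = f b c + f a (b * c)) →
      Set.Finite {i : ι | ∃ p : P, π p = i ∧ ¬ Cob (MulAction.stabilizer Γ p ⊓ V) f})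
    (AxD : ∀ V : Subgroup Γ, IsOpen (V : Set Γ) → V ≤ V₀ → ∀ (p : P) (f g : Γ → Γ → R),
      IsLocallyConstant (fun q : ↥(MulAction.stabilizer Γ p ⊓ V) × ↥(MulAction.stabilizer Γ p ⊓ V) =>
        f q.1 q.2) →
      (∀ a ∈ MulAction.stabilizer Γ p ⊓ V, ∀ b ∈ MulAction.stabilizer Γ p ⊓ V,
        ∀ c ∈ MulAction.stabilizer Γ p ⊓ V, f a b + f (a * b) c = f b c + f a (b * c)) →
      IsLocallyConstant (fun q : ↥(MulAction.stabilizer Γ p ⊓ V) × ↥(MulAction.stabilizer Γ p ⊓ V) =>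
        g q.1 q.2) →
      (∀ a ∈ MulAction.stabilizer Γ p ⊓ V, ∀ b ∈ MulAction.stabilizer Γ p ⊓ V,
        ∀ c ∈ MulAction.stabilizer Γ p ⊓ V, g a b + g (a * b) c = g b c + g a (b * c)) →
      ¬ Cob (MulAction.stabilizer Γ p ⊓ V) f →
        ∃ c : R, Cob (MulAction.stabilizer Γ p ⊓ V) (fun a b => g a b - c * f a b))
    (AxG : ∀ V : Subgroup Γ, IsOpen (V : Set Γ) → V ≤ V₀ → ∀ p₁ p₂ : P, (∀ v ∈ V, v • p₁ ≠ p₂) →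
      ∃ z : Γ → Γ → R, IsLocallyConstant (fun q : V × V => z q.1 q.2) ∧
        (∀ a ∈ V, ∀ b ∈ V, ∀ c ∈ V, z a b + z (a * b) c = z b c + z a (b * c)) ∧
        ¬ Cob (MulAction.stabilizer Γ p₁ ⊓ V) z ∧ Cob (MulAction.stabilizer Γ p₂ ⊓ V) z)
    (AxLn : ∀ (p : P) (W : Subgroup Γ), IsOpen (W : Set Γ) → W ≤ V₀ → ∃ f : Γ → Γ → R,
      IsLocallyConstant (fun q : ↥(MulAction.stabilizer Γ p ⊓ W) × ↥(MulAction.stabilizer Γ p ⊓ W) =>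
        f q.1 q.2) ∧
      (∀ a ∈ MulAction.stabilizer Γ p ⊓ W, ∀ b ∈ MulAction.stabilizer Γ p ⊓ W,
        ∀ c ∈ MulAction.stabilizer Γ p ⊓ W, f a b + f (a * b) c = f b c + f a (b * c)) ∧
      ¬ Cob (MulAction.stabilizer Γ p ⊓ W) f)
    (AxLv : ∀ (p : P) (W W' : Subgroup Γ), IsOpen (W : Set Γ) → IsOpen (W' : Set Γ) → W ≤ V₀ →
      W' ≤ W → ℓ ∣ (MulAction.stabilizer Γ p ⊓ W').relIndex (MulAction.stabilizer Γ p ⊓ W) →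
      ∀ f : Γ → Γ → R,
        IsLocallyConstant (fun q : ↥(MulAction.stabilizer Γ p ⊓ W) × ↥(MulAction.stabilizer Γ p ⊓ W) =>
          f q.1 q.2) →
        (∀ a ∈ MulAction.stabilizer Γ p ⊓ W, ∀ b ∈ MulAction.stabilizer Γ p ⊓ W,
          ∀ c ∈ MulAction.stabilizer Γ p ⊓ W, f a b + f (a * b) c = f b c + f a (b * c)) →
        Cob (MulAction.stabilizer Γ p ⊓ W') f)
    (AxLi : ∀ (p : P) (W W' : Subgroup Γ), IsOpen (W : Set Γ) → IsOpen (W' : Set Γ) → W ≤ V₀ →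
      W' ≤ W → ¬ ℓ ∣ (MulAction.stabilizer Γ p ⊓ W').relIndex (MulAction.stabilizer Γ p ⊓ W) →
      ∀ f : Γ → Γ → R,
        IsLocallyConstant (fun q : ↥(MulAction.stabilizer Γ p ⊓ W) × ↥(MulAction.stabilizer Γ p ⊓ W) =>
          f q.1 q.2) →
        (∀ a ∈ MulAction.stabilizer Γ p ⊓ W, ∀ b ∈ MulAction.stabilizer Γ p ⊓ W,
          ∀ c ∈ MulAction.stabilizer Γ p ⊓ W, f a b + f (a * b) c = f b c + f a (b * c)) →
        Cob (MulAction.stabilizer Γ p ⊓ W') f → Cob (MulAction.stabilizer Γ p ⊓ W) f)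
    {H' : Subgroup Γ} (hH' : IsClosed (H' : Set Γ)) (hH'V₀ : H' ≤ V₀)
    (AxL1 : ∀ N : OpenNormalSubgroup Γ, ∃ x : Γ → Γ → R,
      IsLocallyConstant (fun q : ↥(H' ⊓ (N : Subgroup Γ)) × ↥(H' ⊓ (N : Subgroup Γ)) => x q.1 q.2) ∧
      (∀ a ∈ H' ⊓ (N : Subgroup Γ), ∀ b ∈ H' ⊓ (N : Subgroup Γ), ∀ c ∈ H' ⊓ (N : Subgroup Γ),
        x a b + x (a * b) c = x b c + x a (b * c)) ∧
      ¬ Cob (H' ⊓ (N : Subgroup Γ)) x)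
    (AxL2 : ∀ (N : OpenNormalSubgroup Γ) (f g : Γ → Γ → R),
      IsLocallyConstant (fun q : ↥(H' ⊓ (N : Subgroup Γ)) × ↥(H' ⊓ (N : Subgroup Γ)) => f q.1 q.2) →
      (∀ a ∈ H' ⊓ (N : Subgroup Γ), ∀ b ∈ H' ⊓ (N : Subgroup Γ), ∀ c ∈ H' ⊓ (N : Subgroup Γ),
        f a b + f (a * b) c = f b c + f a (b * c)) →
      IsLocallyConstant (fun q : ↥(H' ⊓ (N : Subgroup Γ)) × ↥(H' ⊓ (N : Subgroup Γ)) => g q.1 q.2) →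
      (∀ a ∈ H' ⊓ (N : Subgroup Γ), ∀ b ∈ H' ⊓ (N : Subgroup Γ), ∀ c ∈ H' ⊓ (N : Subgroup Γ),
        g a b + g (a * b) c = g b c + g a (b * c)) →
      ¬ Cob (H' ⊓ (N : Subgroup Γ)) f → ∃ c : R, Cob (H' ⊓ (N : Subgroup Γ)) (fun a b => g a b - c * f a b)) :
    ∃ p : P, ∀ h : Γ, H'.map (MulAut.conj h).toMonoidHom = H' → h • p = p := by
  classical
  have hCN_closed : ∀ N : OpenNormalSubgroup Γ, IsClosed ((H' ⊓ (N : Subgroup Γ) : Subgroup Γ) : Set Γ) :=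
    fun N => hH'.inter N.toOpenSubgroup.isClosed
  have hCN_V₀ : ∀ N : OpenNormalSubgroup Γ, H' ⊓ (N : Subgroup Γ) ≤ V₀ :=
    fun N => inf_le_left.trans hH'V₀
  -- (U) at the level `H' ⊓ N`, packaged: two primes with bounded `ℓ`-part above `H' ⊓ N` are conjugate
  have hU : ∀ (N : OpenNormalSubgroup Γ) (p₁ p₂ : P) (e₁ e₂ : ℕ),
      (∀ V : Subgroup Γ, IsOpen (V : Set Γ) → H' ⊓ (N : Subgroup Γ) ≤ V → V ≤ V₀ →
        ¬ ℓ ^ (e₁ + 1) ∣ (MulAction.stabilizer Γ p₁ ⊓ V).relIndex (MulAction.stabilizer Γ p₁ ⊓ V₀)) →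
      (∀ V : Subgroup Γ, IsOpen (V : Set Γ) → H' ⊓ (N : Subgroup Γ) ≤ V → V ≤ V₀ →
        ¬ ℓ ^ (e₂ + 1) ∣ (MulAction.stabilizer Γ p₂ ⊓ V).relIndex (MulAction.stabilizer Γ p₂ ⊓ V₀)) →
      ∃ h ∈ H' ⊓ (N : Subgroup Γ), h • p₁ = p₂ := by
    intro N p₁ p₂ e₁ e₂ h₁ h₂
    obtain ⟨V₁, hV₁, hCV₁, hV₁V₀, f₁, hf₁lc, hf₁coc, hf₁⟩ :=
      exists_surviving_of_bounded Cob hV₀ AxLn AxLi (hCN_V₀ N) h₁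
    obtain ⟨V₂, hV₂, hCV₂, hV₂V₀, f₂, hf₂lc, hf₂coc, hf₂⟩ :=
      exists_surviving_of_bounded Cob hV₀ AxLn AxLi (hCN_V₀ N) h₂
    obtain ⟨x, hxlc, hxcoc, hx⟩ := AxL1 N
    have h12 : V₁ ⊓ V₂ ≤ V₁ := inf_le_left
    have h12' : V₁ ⊓ V₂ ≤ V₂ := inf_le_right
    exact exists_mem_smul_eq_of_local_nonvanishing Cob hCob hst AxD AxG (hCN_closed N)
      (fun g hglc hgcoc => AxL2 N x g hxlc hxcoc hglc hgcoc hx) (hV₁.inter hV₂)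
      (le_inf hCV₁ hCV₂) (h12.trans hV₁V₀)
      (lc₂_mono (inf_le_inf_left _ h12) hf₁lc) (coc_mono (inf_le_inf_left _ h12) hf₁coc)
      (fun W hW hCW hW12 => hf₁ W hW hCW (hW12.trans h12))
      (lc₂_mono (inf_le_inf_left _ h12') hf₂lc) (coc_mono (inf_le_inf_left _ h12') hf₂coc)
      (fun W hW hCW hW12 => hf₂ W hW hCW (hW12.trans h12'))
  -- (E) at the level `H' ⊓ N`, packaged: a prime with bounded `ℓ`-part above `H' ⊓ N`
  have hE : ∀ N : OpenNormalSubgroup Γ, ∃ (p : P) (e : ℕ),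
      ∀ V : Subgroup Γ, IsOpen (V : Set Γ) → H' ⊓ (N : Subgroup Γ) ≤ V → V ≤ V₀ →
        ¬ ℓ ^ (e + 1) ∣ (MulAction.stabilizer Γ p ⊓ V).relIndex (MulAction.stabilizer Γ p ⊓ V₀) := by
    intro N
    obtain ⟨x, hxlc, hxcoc, hx⟩ := AxL1 N
    obtain ⟨p, V₁, hV₁, hCV₁, hV₁V₀, y, hylc, hycoc, -, hy⟩ :=
      exists_prime_forall_not_coboundary Cob hCob π hfib hV₀ AxH AxF (hCN_closed N) (hCN_V₀ N)
        hxlc hxcoc hx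
    exact ⟨p, exists_bound_of_forall_not_coboundary Cob hℓ AxLv hV₁ hCV₁ hV₁V₀ hylc hycoc hy⟩
  -- the prime: from `N = ⊤`
  let Ntop : OpenNormalSubgroup Γ := ⟨⊤, by change (⊤ : Subgroup Γ).Normal; infer_instance⟩
  obtain ⟨p, e, hpe⟩ := hE Ntop
  -- transport: the SAME `p` has bounded `ℓ`-part above every `H' ⊓ N`
  have hpN : ∀ N : OpenNormalSubgroup Γ, ∃ e' : ℕ,
      ∀ V : Subgroup Γ, IsOpen (V : Set Γ) → H' ⊓ (N : Subgroup Γ) ≤ V → V ≤ V₀ →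
        ¬ ℓ ^ (e' + 1) ∣ (MulAction.stabilizer Γ p ⊓ V).relIndex (MulAction.stabilizer Γ p ⊓ V₀) := by
    intro N
    obtain ⟨q, e', hq⟩ := hE N
    -- `q` also qualifies above `H' ⊓ ⊤ ⊇ H' ⊓ N`; so `q = h • p` with `h ∈ H'`
    have hq' : ∀ V : Subgroup Γ, IsOpen (V : Set Γ) → H' ⊓ (Ntop : Subgroup Γ) ≤ V → V ≤ V₀ →
        ¬ ℓ ^ (e' + 1) ∣ (MulAction.stabilizer Γ q ⊓ V).relIndex (MulAction.stabilizer Γ q ⊓ V₀) :=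
      fun V hV hCV hVV₀ => hq V hV ((inf_le_inf_left H' le_top).trans hCV) hVV₀
    obtain ⟨h, hh, hhp⟩ := hU Ntop p q e e' hpe hq'
    refine ⟨e', ?_⟩
    -- conjugate back by `h⁻¹`
    have hconj := bounded_conj (V₀ := V₀) hq h⁻¹
    have hfix : (H' ⊓ (N : Subgroup Γ)).map (MulAut.conj h⁻¹).toMonoidHom = H' ⊓ (N : Subgroup Γ) := by
      rw [Subgroup.map_inf _ _ _ (MulAut.conj h⁻¹).injective,
        map_conj_eq_self_of_mem (H'.inv_mem (Subgroup.mem_inf.1 hh).1),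
        map_conj_eq_self_of_normal]
    rw [hfix, ← hhp, inv_smul_smul] at hconj
    exact hconj
  refine ⟨p, fun h hnorm => ?_⟩
  -- orbit closure with the trivial subgroup: `h • p ∈ (H' ⊓ N) • p` for every open normal `N`
  have hbot : IsClosed (((⊥ : Subgroup Γ) : Subgroup Γ) : Set Γ) := by
    rw [Subgroup.coe_bot]
    exact isClosed_singleton
  obtain ⟨g, hg, hgp⟩ := exists_mem_smul_eq_of_forall_open hst hbot (p := p) (q := h • p)
    (fun V hV _ => by
      obtain ⟨N, hNV⟩ := ProfiniteGrp.exist_openNormalSubgroup_sub_open_nhds_of_one hV V.one_mem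
      obtain ⟨e', he'⟩ := hpN N
      -- `h • p` qualifies above `h (H' ⊓ N) h⁻¹ = H' ⊓ N`
      have hconj := bounded_conj (V₀ := V₀) he' h
      have hfix : (H' ⊓ (N : Subgroup Γ)).map (MulAut.conj h).toMonoidHom = H' ⊓ (N : Subgroup Γ) := by
        rw [Subgroup.map_inf _ _ _ (MulAut.conj h).injective, hnorm, map_conj_eq_self_of_normal]
      rw [hfix] at hconj
      obtain ⟨c, hc, hcp⟩ := hU N p (h • p) e' e' he' hconj
      exact ⟨c, hNV (Subgroup.mem_inf.1 hc).2, hcp⟩)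
  rw [Subgroup.mem_bot] at hg
  rw [hg, one_smul] at hgp
  exact hgp.symm

omit [TopologicalSpace Γ] [IsTopologicalGroup Γ] [CompactSpace Γ] [TotallyDisconnectedSpace Γ] hCob in
/-- **Corollary**: a closed subgroup `H'` of local type lies in a decomposition group: `H' ≤ D p`
for the prime `p` of `exists_prime_smul_eq_of_localType` (every `h ∈ H'` normalises `H'`).
[cite: NeukirchSchmidtWingberg2008, Prop (12.1.9)] -/
theorem le_stabilizer_of_forall_conj {H' : Subgroup Γ} {p : P}
    (hp : ∀ h : Γ, H'.map (MulAut.conj h).toMonoidHom = H' → h • p = p) :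
    H' ≤ MulAction.stabilizer Γ p :=
  fun h hh => MulAction.mem_stabilizer_iff.2 (hp h (map_conj_eq_self_of_mem hh))

end Main

end Literature.NumberTheory.GaloisRepresentations.NeukirchAbstract
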